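import Mathlib
import HarnessLib
import Literature.MathematicalPhysics.QuantumLattice.GaugeGroups
import Summits.Ventures.LatticeQCDFlow.Exactness.Overrelaxation

/-!
# The Wilson link action is conserved by the over-relaxation reflection `U ↦ ŝ U⁻¹ ŝ`

HONEST FRAMING: exact (Metropolis-corrected) sampling algorithms for lattice gauge theory;
figures of merit are autocorrelation/cost numbers at stated couplings and volumes; no
continuum-physics claim.

Venture `LatticeQCDFlow` (cell pub-lqcd), topic `Exactness`, FANOUT row 9 (eng-latcore, the
engine `latflow.core`: `updates.sweep(f, beta, 'or', rng)`).  NEW WORK of the cell (elementary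
matrix algebra over Mathlib); nothing is cited as a fact.  Printed counterparts, named only:
Creutz 1987 / Brown–Woch 1987 (over-relaxation), Adler 1981.

`Overrelaxation.lean` proves `overrelaxation_isReversible`: on a group with a left-, right- and
inversion-invariant measure the deterministic move `g ↦ s g⁻¹ s` is exact for `e^{−H} μ` for every
measurable `H` with `H (s g⁻¹ s) = H g`, and leaves that model-specific identity for the Wilson
action — "the engine checks numerically (acceptance test A5), not typed here".  It is typed here.

## Content (`n` a finite index type; matrices over `ℂ`; `Aᴴ` the conjugate transpose)

* `re_trace_conjTranspose`, `re_trace_mul_conjTranspose_comm` — `Re tr Aᴴ = Re tr A`, hence the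
  real Frobenius pairing `Re tr (A Bᴴ)` is symmetric.
* `wilsonLink c R U = −c · Re tr (U Rᴴ)` — the part of the Wilson action that involves one link
  `U` with staple sum `R` (`c = β/N`).
* **`re_trace_reflect`** — for ANY square matrix `g`, any `s` with `s sᴴ = 1` and any real `k`:
  `Re tr ((s gᴴ s) (k s)ᴴ) = Re tr (g (k s)ᴴ)`.  Proof: `(s gᴴ s)(k sᴴ) = k s gᴴ` and
  `Re tr (s gᴴ) = Re tr ((g sᴴ)ᴴ) = Re tr (g sᴴ)`.  No unitarity of `g`, no `n = 2`, no
  determinant condition is used: the identity holds in `U(N)` for every `N` as soon as the staple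
  sum is a real multiple of a unitary — which for `N = 2` is automatic (sums of quaternions) and for
  `N ≥ 3` is arranged by Cabibbo–Marinari inside each SU(2) subgroup.
* `wilsonLink_reflect`, `unitaryGroup_wilsonLink_reflect`, `specialUnitaryGroup_wilsonLink_reflect`
  — the hypothesis `H (s g⁻¹ s) = H g` of `overrelaxation_isReversible`, discharged for
  `H = wilsonLink c (k • s)` on `U(n)` and `SU(n)` (`g⁻¹ = gᴴ` there).
* **`wilsonOverrelaxation_isReversible`** (`SU(n)`, Borel structure of
  `Literature/MathematicalPhysics/QuantumLattice/GaugeGroups.lean`) and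
  `unitaryWilsonOverrelaxation_isReversible` (`U(n)`): for every left-, right- and
  inversion-invariant measure `μ` (normalised Haar), every `c`, `k : ℝ` and every group element `s`,
  the over-relaxation move through `s` is reversible — exact with acceptance one — for
  `e^{c Re tr (U (k s)ᴴ)} μ`, i.e. for the conditional law of one link whose staple sum is `k s`.

Not here: that an SU(2) staple sum IS `k ŝ` with `ŝ ∈ SU(2)` (quaternion algebra), the lift to the
whole lattice (`LocalInvolution.lean` / `FibreLift.lean` do that for any fibrewise-exact move),
ergodicity (over-relaxation conserves the action; the heat bath supplies ergodicity).
-/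

namespace Summit.Ventures.LatticeQCDFlow.Exactness

open Matrix MeasureTheory ProbabilityTheory
open scoped ENNReal

variable {n : Type*} [Fintype n] [DecidableEq n]

/-! ## §1 The trace identity -/

omit [DecidableEq n] in
/-- `Re tr Aᴴ = Re tr A`. -/
theorem re_trace_conjTranspose (A : Matrix n n ℂ) : (Aᴴ.trace).re = (A.trace).re := by
  rw [Matrix.trace_conjTranspose, Complex.star_def, Complex.conj_re]

omit [DecidableEq n] in
/-- The real Frobenius pairing is symmetric: `Re tr (A Bᴴ) = Re tr (B Aᴴ)`. -/
theorem re_trace_mul_conjTranspose_comm (A B : Matrix n n ℂ) :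
    ((A * Bᴴ).trace).re = ((B * Aᴴ).trace).re := by
  rw [← re_trace_conjTranspose (B * Aᴴ), conjTranspose_mul, conjTranspose_conjTranspose]

/-- The one-link part of the Wilson action against the staple sum `R`: `−c · Re tr (U Rᴴ)`
(`c = β/N`; everything not involving the link `U` is dropped). -/
noncomputable def wilsonLink (c : ℝ) (R U : Matrix n n ℂ) : ℝ := -(c * ((U * Rᴴ).trace).re)

/-- **Key identity.**  For every square matrix `g`, every `s` with `s sᴴ = 1` and every real `k`:
`Re tr ((s gᴴ s) (k s)ᴴ) = Re tr (g (k s)ᴴ)`. -/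
theorem re_trace_reflect (s g : Matrix n n ℂ) (hs : s * sᴴ = 1) (k : ℝ) :
    ((s * gᴴ * s * ((k : ℂ) • s)ᴴ).trace).re = ((g * ((k : ℂ) • s)ᴴ).trace).re := by
  have h1 : s * gᴴ * s * ((k : ℂ) • s)ᴴ = (k : ℂ) • (s * gᴴ) := by
    rw [conjTranspose_smul, Complex.star_def, Complex.conj_ofReal, Matrix.mul_smul,
      Matrix.mul_assoc (s * gᴴ), hs, Matrix.mul_one]
  have h2 : g * ((k : ℂ) • s)ᴴ = (k : ℂ) • (g * sᴴ) := by
    rw [conjTranspose_smul, Complex.star_def, Complex.conj_ofReal, Matrix.mul_smul]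
  rw [h1, h2, trace_smul, trace_smul, smul_eq_mul, smul_eq_mul, Complex.re_ofReal_mul,
    Complex.re_ofReal_mul, re_trace_mul_conjTranspose_comm g s]

/-- The one-link Wilson action with staple sum `k s`, `s sᴴ = 1`, is conserved by `g ↦ s gᴴ s`. -/
theorem wilsonLink_reflect (c k : ℝ) (s g : Matrix n n ℂ) (hs : s * sᴴ = 1) :
    wilsonLink c ((k : ℂ) • s) (s * gᴴ * s) = wilsonLink c ((k : ℂ) • s) g := by
  unfold wilsonLink
  rw [re_trace_reflect s g hs k]

/-! ## §2 Group form: the hypothesis of `overrelaxation_isReversible`, discharged -/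

/-- In `U(n)` (`g⁻¹ = gᴴ`): `H (s g⁻¹ s) = H g` for `H = wilsonLink c (k • s)`. -/
theorem unitaryGroup_wilsonLink_reflect (c k : ℝ) (s g : Matrix.unitaryGroup n ℂ) :
    wilsonLink c ((k : ℂ) • (s : Matrix n n ℂ)) (↑(s * g⁻¹ * s) : Matrix n n ℂ) =
      wilsonLink c ((k : ℂ) • (s : Matrix n n ℂ)) (g : Matrix n n ℂ) := by
  have hs : (s : Matrix n n ℂ) * (s : Matrix n n ℂ)ᴴ = 1 := by
    rw [← Matrix.star_eq_conjTranspose]; exact Unitary.coe_mul_star_self s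
  have hcoe : (↑(s * g⁻¹ * s) : Matrix n n ℂ) = (s : Matrix n n ℂ) * (g : Matrix n n ℂ)ᴴ * s := by
    rw [Submonoid.coe_mul, Submonoid.coe_mul, Matrix.UnitaryGroup.inv_val, Matrix.star_eq_conjTranspose]
  rw [hcoe]
  exact wilsonLink_reflect c k _ _ hs

/-- In `SU(n)` (`g⁻¹ = gᴴ`): `H (s g⁻¹ s) = H g` for `H = wilsonLink c (k • s)`. -/
theorem specialUnitaryGroup_wilsonLink_reflect (c k : ℝ) (s g : Matrix.specialUnitaryGroup n ℂ) :
    wilsonLink c ((k : ℂ) • (s : Matrix n n ℂ)) (↑(s * g⁻¹ * s) : Matrix n n ℂ) =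
      wilsonLink c ((k : ℂ) • (s : Matrix n n ℂ)) (g : Matrix n n ℂ) := by
  have hsU : (s : Matrix n n ℂ) ∈ Matrix.unitaryGroup n ℂ := (Matrix.mem_specialUnitaryGroup_iff.mp s.2).1
  have hs : (s : Matrix n n ℂ) * (s : Matrix n n ℂ)ᴴ = 1 := by
    rw [← Matrix.star_eq_conjTranspose]; exact Unitary.mul_star_self_of_mem hsU
  have hcoe : (↑(s * g⁻¹ * s) : Matrix n n ℂ) = (s : Matrix n n ℂ) * (g : Matrix n n ℂ)ᴴ * s := by
    rw [Submonoid.coe_mul, Submonoid.coe_mul, ← Matrix.star_eq_inv, Matrix.specialUnitaryGroup.coe_star,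
      Matrix.star_eq_conjTranspose]
  rw [hcoe]
  exact wilsonLink_reflect c k _ _ hs

/-! ## §3 Over-relaxation of one Wilson link is exact -/

omit [DecidableEq n] in
/-- The one-link Wilson action is continuous in the link. -/
theorem continuous_wilsonLink (c : ℝ) (R : Matrix n n ℂ) : Continuous (wilsonLink c R) := by
  unfold wilsonLink
  exact (continuous_const.mul (Complex.continuous_re.comp
    ((continuous_id.matrix_mul continuous_const).matrix_trace))).neg

/-- **Over-relaxation of one SU(n) link is exact.**  For every left-, right- and inversion-invariant
measure `μ` on `SU(n)` (normalised Haar), every `c k : ℝ` and every `s ∈ SU(n)`, the deterministic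
move `g ↦ s g⁻¹ s` is reversible with respect to `e^{−wilsonLink c (k s)} μ = e^{c Re tr (g (k s)ᴴ)} μ`
— the conditional law of a link whose staple sum is `k s` (`c = β/N`). -/
theorem wilsonOverrelaxation_isReversible (μ : Measure (Matrix.specialUnitaryGroup n ℂ))
    [μ.IsMulLeftInvariant] [μ.IsMulRightInvariant] [μ.IsInvInvariant] (c k : ℝ)
    (s : Matrix.specialUnitaryGroup n ℂ) :
    Kernel.IsReversible
      (Kernel.deterministic (reflectThrough s) (measurePreserving_reflectThrough μ s).measurable)
      (μ.withDensity fun g => ENNReal.ofReal (Real.exp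
        (-wilsonLink c ((k : ℂ) • (s : Matrix n n ℂ)) (g : Matrix n n ℂ)))) :=
  overrelaxation_isReversible ((continuous_wilsonLink c _).comp continuous_subtype_val).measurable s
    fun g => specialUnitaryGroup_wilsonLink_reflect c k s g

/-- … and the link law is invariant under the move. -/
theorem wilsonOverrelaxation_invariant (μ : Measure (Matrix.specialUnitaryGroup n ℂ))
    [μ.IsMulLeftInvariant] [μ.IsMulRightInvariant] [μ.IsInvInvariant] (c k : ℝ)
    (s : Matrix.specialUnitaryGroup n ℂ) :
    Kernel.Invariant
      (Kernel.deterministic (reflectThrough s) (measurePreserving_reflectThrough μ s).measurable)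
      (μ.withDensity fun g => ENNReal.ofReal (Real.exp
        (-wilsonLink c ((k : ℂ) • (s : Matrix n n ℂ)) (g : Matrix n n ℂ)))) :=
  overrelaxation_invariant ((continuous_wilsonLink c _).comp continuous_subtype_val).measurable s
    fun g => specialUnitaryGroup_wilsonLink_reflect c k s g

/-- The same on `U(n)`. -/
theorem unitaryWilsonOverrelaxation_isReversible (μ : Measure (Matrix.unitaryGroup n ℂ))
    [μ.IsMulLeftInvariant] [μ.IsMulRightInvariant] [μ.IsInvInvariant] (c k : ℝ)
    (s : Matrix.unitaryGroup n ℂ) :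
    Kernel.IsReversible
      (Kernel.deterministic (reflectThrough s) (measurePreserving_reflectThrough μ s).measurable)
      (μ.withDensity fun g => ENNReal.ofReal (Real.exp
        (-wilsonLink c ((k : ℂ) • (s : Matrix n n ℂ)) (g : Matrix n n ℂ)))) :=
  overrelaxation_isReversible ((continuous_wilsonLink c _).comp continuous_subtype_val).measurable s
    fun g => unitaryGroup_wilsonLink_reflect c k s g

end Summit.Ventures.LatticeQCDFlow.Exactness
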